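import Summits.ABC.ABC.Theses.DefiniteXi
import Literature.NumberTheory.Automorphic.BrandtEigenvectorNonEisenstein
import Literature.NumberTheory.Automorphic.BrandtEigenvectorDegreeZero
import Literature.NumberTheory.Automorphic.EichlerSubidealCount
import Literature.NumberTheory.EllipticCurves.CongruenceNumber
import Literature.NumberTheory.EllipticCurves.NewformsMultiplicityOneProofs
import Literature.NumberTheory.EllipticCurves.ModularCurveManinSemistableBridgeProofs
import Literature.NumberTheory.EllipticCurves.SzpiroFreyConductorProofs
import HarnessLib

/-!
# Sketch (stub-ideation k=3 · GEN 4 · FAMILY 3 PROBE THE EXTREMES) for `stub_xiDegreeComparison`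
# of crux `SteinbergCore` (route-ABC-DefiniteXi, line `p6_tamagawa_split`):
# the MAZUR-FREE tail of the theta-lattice transfer — quantitative Eisenstein control.

Companion to `STUB-IDEAS-stub_xiDegreeComparison-3.md` (gen 4).  The three seats converged on
k2's chain `H1 → H2/H3/H4 → (T) kernel (PROVED, k2 gen 4) → H5core → H5 → H6`, whose prime-wise
step H5 needs a NON-EISENSTEIN WITNESS `∃ ℓ ∤ N, p ∤ a_ℓ(E) − (ℓ+1)` for every `p ≥ 5`, imported
from Mazur–Kenku (`mazurKenku_exists_cyclic_isogeny`, an unproved named fact of the tree) via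
`hasIrreducibleModPGaloisRep_freyCurve_of_mazurKenku`.

Gen-4 anatomy of the minimal Eisenstein counterexample (11a1 at `p = 5`: `ξ(1,11) = w₁ + w₂ = 5`,
`m_E = r_E = 1`; `5 ∣ #E(𝔽_ℓ)` for every good `ℓ`, `#E(𝔽₂) = 5`) says the Eisenstein EXCESS
`v_p ξ − v_p r_f` is exactly controlled by point counts.  Typed here:

* L1  `dvd_sub_of_forall_dvd_weight_mul_sub_of_isCoprime` (PROVED) — the tree's mod-`p`
  Eisenstein criterion `Brandt.dvd_sub_of_forall_dvd_weight_mul_sub` for an ARBITRARY modulus `m`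
  coprime to one weighted coordinate (so prime powers): `m ∣ w_cφ_c − w_dφ_d ∀ c d ⟹ m ∣ λ(ℓ) − (ℓ+1)`.
* L1′ `XiSetup.dvd_sub_prime_add_one_of_forall_dvd_of_isCoprime` (PROVED) — setup form.
* L1″ `XiSetup.exists_not_pow_dvd_weight_mul_sub` (PROVED) — prime-power witness pair.
* L2  `factorization_le_of_core` (PROVED, the NEW HELPER): from k2's H5core divisibility ALONE (taken as a
  hypothesis `hcore`, no theta series in this file) `v_p ξ ≤ v_p r + v_p |a_ℓ(W) − (ℓ+1)|` for every
  `p ≥ 5` and EVERY prime `ℓ ∤ N⁺N⁻` — no irreducibility, no Mazur.  (`ℓ + 1 − a_ℓ = #Ẽ(𝔽_ℓ) ≠ 0`,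
  tree `WeierstrassCurve.lFunction_ne_prime_add_one`.)
* L3  `exists_prime_not_dvd_le_rpow` (sorry, S) — the least prime `ℓ ∤ N` is `≤ C_ε N^ε` (tree
  `LLLFactoring.exists_prime_le_not_dvd`: `ℓ ≤ 64 (log₂ N + 1)²`).
* L4  `natAbs_lFunction_sub_le`, `natAbs_lFunction_sub_ne_zero` (PROVED) — Hasse packaging `0 ≠ |a_ℓ − (ℓ+1)| ≤ 4ℓ`.
* L5  `primeToSix_le_mul_of_factorization_le` (sorry, XS) — `cps` bookkeeping.
* L6  `factorization_congruenceNumber_le_deg` (sorry, S) — ARS 2.1(b) at the lattice-optimal datum, `p ≥ 5`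
  (shared with k2's H6; `p² ∤ N_Frey` by `conductorNorm_freyCurve_dvd_holds`).
* L7  `stub_xiDegreeComparison_of_core` (sorry, S) — assembly with `C := 4·C_ε`, trust base
  {`XiCoreDivisibility` (= k2 H5core, itself ⇐ H1), ARS 2.1(b), `FreyModularity`} — `ε > 0` is USED
  (honours `Disproof.steinbergCore_false_without_eps_pos`), Mazur–Kenku is NOT.
-/

set_option linter.dupNamespace false

noncomputable section

namespace Summit.ABC.ABC.Cruxes.SteinbergCore.ProbeExtremesG4

open scoped MatrixGroups ModularForm Matrix
open CongruenceSubgroup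
open Literature.NumberTheory.EllipticCurves Literature.NumberTheory.EllipticCurves.ModularForms
open Literature.NumberTheory.Automorphic Literature.NumberTheory.Automorphic.Brandt

/-! ## L1 — the Eisenstein criterion for an arbitrary modulus (PROVED) -/

/-- **L1 (abstract, PROVED).**  `T` self-adjoint for the weights `w`, constant column sums `s`,
`T v = λ v`; if `m` is coprime to `w_{i₀} v_{i₀}` and `m ∣ w_i v_i − w_j v_j` for all `i, j`, then
`m ∣ λ − s`.  Same computation as the tree's `Brandt.dvd_sub_of_forall_dvd_weight_mul_sub`
(`(λ − s) μ = Σ_i T_{i i₀} (h_i − μ)`), last step `IsCoprime.dvd_of_dvd_mul_right` instead of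
`Prime.dvd_or_dvd`. [cite: Gross1987, §2 (Eisenstein vector)] -/
theorem dvd_sub_of_forall_dvd_weight_mul_sub_of_isCoprime {ι : Type*} [Fintype ι] {R : Type*}
    [CommRing R] (T : Matrix ι ι R) (w : ι → R) {lam s : R} {v : ι → R}
    (hsymm : ∀ i j, w i * T i j = w j * T j i) (hcol : ∀ j, ∑ i, T i j = s)
    (hv : T *ᵥ v = lam • v) {m : R} {i₀ : ι} (h0 : IsCoprime m (w i₀ * v i₀))
    (hcong : ∀ i j, m ∣ w i * v i - w j * v j) : m ∣ lam - s := by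
  have heig := sum_mul_weight_mul_eq_of_mulVec_eq_smul T w hsymm hv i₀
  have key : (lam - s) * (w i₀ * v i₀) = ∑ i, T i i₀ * (w i * v i - w i₀ * v i₀) := by
    have h1 : ∑ i, T i i₀ * (w i * v i - w i₀ * v i₀) =
        ∑ i, T i i₀ * (w i * v i) - (∑ i, T i i₀) * (w i₀ * v i₀) := by
      rw [Finset.sum_mul, ← Finset.sum_sub_distrib]
      exact Finset.sum_congr rfl fun i _ => by ring
    rw [h1, heig, hcol i₀]
    ring
  have hdvd : m ∣ (lam - s) * (w i₀ * v i₀) := by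
    rw [key]
    exact Finset.dvd_sum fun i _ => Dvd.dvd.mul_left (hcong i i₀) _
  exact h0.dvd_of_dvd_mul_right hdvd

variable {Nplus Nminus : ℕ}

/-- **L1′ (setup form, PROVED).**  In a definite Brandt setup, if an integer `m` coprime to
`w_{c₀} v_{c₀}` divides all `w_c v_c − w_{c'} v_{c'}` for an eigenvector `v ∈ L(λ)`, then
`m ∣ λ(ℓ) − (ℓ + 1)` for every prime `ℓ ∤ N⁺N⁻` (weight symmetry `XiSetup.weight_mul_matrix_symm`,
Eichler column sums `XiSetup.sum_matrix_prime_eq`).  The tree's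
`XiSetup.dvd_sub_prime_add_one_of_forall_dvd` is the case `m = p ≥ 5` prime.
[cite: Ribet1990, §3 Thm. 3.12] [cite: PollackWeston2011, Prop. 6.3] -/
theorem XiSetup.dvd_sub_prime_add_one_of_forall_dvd_of_isCoprime (S : XiSetup Nplus Nminus)
    [Fintype (ClassSet S.O)] {lam : ℕ → ℤ} {v : ClassSet S.O → ℤ}
    (hv : v ∈ eigenLattice (Nplus * Nminus) (matrix S.O) lam) {m : ℤ} {c₀ : ClassSet S.O}
    (hm : IsCoprime m ((weight S.O c₀ : ℤ) * v c₀))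
    (hcong : ∀ c c', m ∣ (weight S.O c : ℤ) * v c - (weight S.O c' : ℤ) * v c')
    {ℓ : ℕ} (hℓ : ℓ.Prime) (hℓN : ¬ ℓ ∣ Nplus * Nminus) :
    m ∣ lam ℓ - (ℓ + 1) :=
  dvd_sub_of_forall_dvd_weight_mul_sub_of_isCoprime (matrix S.O ℓ) (fun c => (weight S.O c : ℤ))
    (fun i j => S.weight_mul_matrix_symm ℓ i j) (fun j => S.sum_matrix_prime_eq hℓ hℓN j)
    (hv ℓ hℓ hℓN) hm hcong

/-- **L1″ (prime-power witness; PROVED from L1′).**  For `p ≥ 5`, `p ∤ φ_{c₀}` and a prime `ℓ ∤ N⁺N⁻`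
with `e = v_p(ℓ + 1 − λ(ℓ))` (finite: the hypothesis `hne`), some pair of classes has
`p^{e+1} ∤ w_c φ_c − w_d φ_d` (contrapositive of L1′ with `m = p^{e+1}`; coprimality from
`XiSetup.not_dvd_weight` + `Prime.coprime_iff_not_dvd` + `IsCoprime.pow_left`). -/
theorem XiSetup.exists_not_pow_dvd_weight_mul_sub (S : XiSetup Nplus Nminus)
    [Fintype (ClassSet S.O)] {lam : ℕ → ℤ} {v : ClassSet S.O → ℤ}
    (hv : v ∈ eigenLattice (Nplus * Nminus) (matrix S.O) lam) {p : ℕ} (hp : p.Prime)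
    (h5 : 5 ≤ p) {c₀ : ClassSet S.O} (hv0 : ¬ (p : ℤ) ∣ v c₀)
    {ℓ : ℕ} (hℓ : ℓ.Prime) (hℓN : ¬ ℓ ∣ Nplus * Nminus) {e : ℕ}
    (hne : ¬ (p : ℤ) ^ (e + 1) ∣ lam ℓ - (ℓ + 1)) :
    ∃ c c' : ClassSet S.O,
      ¬ (p : ℤ) ^ (e + 1) ∣ (weight S.O c : ℤ) * v c - (weight S.O c' : ℤ) * v c' := by
  by_contra h
  push Not at h
  have hpZ : Prime (p : ℤ) := Nat.prime_iff_prime_int.mp hp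
  have hw0 : ¬ (p : ℤ) ∣ (weight S.O c₀ : ℤ) * v c₀ := by
    intro hd
    rcases hpZ.dvd_or_dvd hd with h1 | h1
    · exact S.not_dvd_weight c₀ hp h5 (Int.natCast_dvd_natCast.mp h1)
    · exact hv0 h1
  have hcop : IsCoprime ((p : ℤ) ^ (e + 1)) ((weight S.O c₀ : ℤ) * v c₀) :=
    ((Prime.coprime_iff_not_dvd hpZ).mpr hw0).pow_left
  exact hne (XiSetup.dvd_sub_prime_add_one_of_forall_dvd_of_isCoprime S hv hcop h hℓ hℓN)

/-! ## L4 — Hasse packaging -/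

/-- **L4 (PROVED).** `|a_ℓ(W) − (ℓ + 1)| ≤ ℓ + 1 + 2√ℓ ≤ 4ℓ` (`WeierstrassCurve.abs_LFunction_prime_pow_le`
with `k = 1`), and it is `≠ 0` (`WeierstrassCurve.lFunction_ne_prime_add_one`). [folklore] -/
theorem natAbs_lFunction_sub_le (W : WeierstrassCurve ℚ) [W.IsElliptic] {ℓ : ℕ} (hℓ : ℓ.Prime) :
    (((W.LFunction ℓ - (ℓ + 1)).natAbs : ℕ) : ℝ) ≤ 4 * ℓ := by
  have hb := W.abs_LFunction_prime_pow_le hℓ 1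
  rw [pow_one, pow_one] at hb
  have hle : |(W.LFunction ℓ : ℝ)| ≤ 2 * Real.sqrt ℓ := by norm_num at hb ⊢; exact hb
  have hℓ1 : (1 : ℝ) ≤ ℓ := by exact_mod_cast hℓ.one_lt.le
  have hsq : Real.sqrt ℓ ≤ ℓ := by
    calc Real.sqrt ℓ ≤ Real.sqrt ((ℓ : ℝ) ^ 2) := Real.sqrt_le_sqrt (by nlinarith)
      _ = ℓ := Real.sqrt_sq (by positivity)
  rw [Nat.cast_natAbs, Int.cast_abs]
  push_cast
  calc |(W.LFunction ℓ : ℝ) - (ℓ + 1)| ≤ |(W.LFunction ℓ : ℝ)| + |((ℓ : ℝ) + 1)| := abs_sub _ _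
    _ ≤ 2 * Real.sqrt ℓ + (ℓ + 1) := by
        rw [abs_of_nonneg (by positivity : (0 : ℝ) ≤ (ℓ : ℝ) + 1)]; linarith
    _ ≤ 4 * ℓ := by nlinarith

theorem natAbs_lFunction_sub_ne_zero (W : WeierstrassCurve ℚ) [W.IsElliptic] {ℓ : ℕ}
    (hℓ : ℓ.Prime) : (W.LFunction ℓ - (ℓ + 1)).natAbs ≠ 0 := by
  rw [ne_eq, Int.natAbs_eq_zero, sub_eq_zero]
  exact W.lFunction_ne_prime_add_one hℓ

/-! ## L2 — THE NEW HELPER: quantitative Eisenstein control from the core divisibility alone -/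

/-- **L2 (PROVED · Mazur-free prime-wise transfer).**  Let `φ` generate the `a(W)`-eigen-line of a
definite setup and suppose the CORE DIVISIBILITY (k2's H5core, here a hypothesis):
`x ∣ |2 w_i φ_i ⟨φ, y⟩_w| · r` for every row `i` and every degree-zero `y`.  Then for every prime
`p ≥ 5` and EVERY prime `ℓ ∤ N⁺N⁻`:  `v_p x ≤ v_p r + v_p |a_ℓ(W) − (ℓ + 1)|`.
Proof: `e := v_p |a_ℓ − (ℓ+1)|` (`≠ 0` by `WeierstrassCurve.lFunction_ne_prime_add_one`);
`c₀` with `p ∤ φ_{c₀}` (`exists_not_dvd_of_eigenLattice_eq_span`), `p ∤ w_{c₀}`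
(`XiSetup.not_dvd_weight`); L1″ gives `c, d` with `p^{e+1} ∤ δ := w_cφ_c − w_dφ_d`, so `δ ≠ 0`,
`v_p δ ≤ e`; `y := e_c − e_d` has degree `0` and `⟨φ, y⟩_w = δ`; `hcore c₀ y`:
`x ∣ |2 w_{c₀} φ_{c₀} δ| · r ≠ 0`, whence `v_p x ≤ v_p 2 + v_p (w_{c₀}φ_{c₀}) + v_p δ + v_p r = v_p δ + v_p r`
(`Nat.factorization_le_iff_dvd`-style bookkeeping; `x = 0` is trivial). No irreducibility input. -/
theorem factorization_le_of_core (S : XiSetup Nplus Nminus) [Fintype (ClassSet S.O)]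
    [DecidableEq (ClassSet S.O)] (W : WeierstrassCurve ℚ) [W.IsElliptic]
    {φ : ClassSet S.O → ℤ} (hφ0 : φ ≠ 0)
    (hL : eigenLattice (Nplus * Nminus) (matrix S.O) (fun n => W.LFunction n) = ℤ ∙ φ)
    {x r : ℕ} (hr : r ≠ 0)
    (hcore : ∀ (i : ClassSet S.O) (y : ClassSet S.O → ℤ), ∑ c, y c = 0 →
      x ∣ (2 * (weight S.O i : ℤ) * φ i * ∑ c, (weight S.O c : ℤ) * φ c * y c).natAbs * r)
    {p : ℕ} (hp : p.Prime) (h5 : 5 ≤ p) {ℓ : ℕ} (hℓ : ℓ.Prime) (hℓN : ¬ ℓ ∣ Nplus * Nminus) :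
    x.factorization p ≤ r.factorization p + (W.LFunction ℓ - (ℓ + 1)).natAbs.factorization p := by
  have hpZ : Prime (p : ℤ) := Nat.prime_iff_prime_int.mp hp
  have hE0 : (W.LFunction ℓ - (ℓ + 1)).natAbs ≠ 0 := natAbs_lFunction_sub_ne_zero W hℓ
  -- `p^{e+1} ∤ a_ℓ - (ℓ+1)` for `e = v_p |a_ℓ - (ℓ+1)|`
  have hne : ¬ (p : ℤ) ^ ((W.LFunction ℓ - (ℓ + 1)).natAbs.factorization p + 1) ∣
      W.LFunction ℓ - (ℓ + 1) := by
    intro hd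
    have hd' : p ^ ((W.LFunction ℓ - (ℓ + 1)).natAbs.factorization p + 1) ∣
        (W.LFunction ℓ - (ℓ + 1)).natAbs := Int.natCast_dvd.mp (by exact_mod_cast hd)
    exact Nat.pow_succ_factorization_not_dvd hE0 hp hd'
  -- a class `c₀` with `p ∤ φ_{c₀}`; `φ ∈ L(a(W))`
  obtain ⟨c₀, hc₀⟩ := exists_not_dvd_of_eigenLattice_eq_span hφ0 hL hp
  have hφL : φ ∈ eigenLattice (Nplus * Nminus) (matrix S.O) (fun n => W.LFunction n) :=
    hL ▸ Submodule.mem_span_singleton_self φ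
  -- L1″: two classes whose weighted coordinates are NOT congruent modulo `p^{e+1}`
  obtain ⟨c, d, hcd⟩ := XiSetup.exists_not_pow_dvd_weight_mul_sub S hφL hp h5 hc₀ hℓ hℓN hne
  set δ : ℤ := (weight S.O c : ℤ) * φ c - (weight S.O d : ℤ) * φ d with hδ
  have hδ0 : δ ≠ 0 := by
    intro h; apply hcd; rw [h]; exact dvd_zero _
  have hδe : δ.natAbs.factorization p ≤ (W.LFunction ℓ - (ℓ + 1)).natAbs.factorization p := by
    by_contra hlt
    push Not at hlt
    apply hcd
    have h1 : p ^ ((W.LFunction ℓ - (ℓ + 1)).natAbs.factorization p + 1) ∣ δ.natAbs :=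
      (hp.pow_dvd_iff_le_factorization (Int.natAbs_ne_zero.mpr hδ0)).mpr hlt
    exact_mod_cast Int.natCast_dvd.mpr h1
  -- the degree-zero test vector `y = e_c - e_d`, `⟨φ, y⟩_w = δ`
  set y : ClassSet S.O → ℤ := Pi.single c 1 - Pi.single d 1 with hy
  have hy0 : ∑ i, y i = 0 := by
    simp only [hy, Pi.sub_apply, Pi.single_apply, Finset.sum_sub_distrib, Finset.sum_ite_eq',
      Finset.mem_univ, if_true, sub_self]
  have hpair : ∑ i, (weight S.O i : ℤ) * φ i * y i = δ := by
    simp only [hy, hδ, Pi.sub_apply, Pi.single_apply, mul_sub, mul_ite, mul_one, mul_zero,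
      Finset.sum_sub_distrib, Finset.sum_ite_eq', Finset.mem_univ, if_true]
  -- the core divisibility at `(c₀, y)`: `x ∣ |2 w_{c₀} φ_{c₀}| · (|δ| · r)`
  have hdiv := hcore c₀ y hy0
  rw [hpair, Int.natAbs_mul, mul_assoc] at hdiv
  -- `p ∤ 2 w_{c₀} φ_{c₀}`
  have hA : ¬ p ∣ (2 * (weight S.O c₀ : ℤ) * φ c₀).natAbs := by
    intro hd
    have hd' : (p : ℤ) ∣ 2 * (weight S.O c₀ : ℤ) * φ c₀ := Int.natCast_dvd.mpr hd
    rcases hpZ.dvd_or_dvd hd' with h2 | h2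
    · rcases hpZ.dvd_or_dvd h2 with h3 | h3
      · have h4 : p ∣ 2 := by exact_mod_cast h3
        have := Nat.le_of_dvd two_pos h4
        omega
      · exact S.not_dvd_weight c₀ hp h5 (Int.natCast_dvd_natCast.mp h3)
    · exact hc₀ h2
  -- strip the `p`-free factor and read off valuations
  have h1 : p ^ x.factorization p ∣ δ.natAbs * r :=
    (Nat.Coprime.pow_left _ ((Nat.Prime.coprime_iff_not_dvd hp).mpr hA)).dvd_of_dvd_mul_left
      ((Nat.ordProj_dvd x p).trans hdiv)
  have hδr : δ.natAbs * r ≠ 0 := mul_ne_zero (Int.natAbs_ne_zero.mpr hδ0) hr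
  have h2 := (hp.pow_dvd_iff_le_factorization hδr).mp h1
  rw [Nat.factorization_mul (Int.natAbs_ne_zero.mpr hδ0) hr, Finsupp.add_apply] at h2
  omega

/-- **L2, packaged as the property the assembly consumes** (k2's H5core conclusion, verbatim the
statement of `ThetaTransferG3.xi_dvd_mul_congruenceNumber` with H1 discharged into it): the CORE
DIVISIBILITY for every definite setup / curve / newform.  k2 gen 3–4 derive it from H1
(`brandtTheta_sub_isCuspForm`) through H2–H4 and the PROVED transfer template (T). -/
def XiCoreDivisibility : Prop :=
  ∀ (Nplus Nminus M : ℕ) [NeZero M], Nplus * Nminus = M →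
    ∀ (S : XiSetup Nplus Nminus) [Fintype (ClassSet S.O)] (W : WeierstrassCurve ℚ) [W.IsElliptic]
      (f : CuspForm (Gamma0 M) 2), IsNewformOf W f →
    ∀ (φ : ClassSet S.O → ℤ), φ ≠ 0 →
      eigenLattice (Nplus * Nminus) (matrix S.O) (fun n => W.LFunction n) = ℤ ∙ φ →
    ∀ (i : ClassSet S.O) (y : ClassSet S.O → ℤ), ∑ c, y c = 0 →
      (S.xi fun n => W.LFunction n) ∣
        (2 * (weight S.O i : ℤ) * φ i * ∑ c, (weight S.O c : ℤ) * φ c * y c).natAbs *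
          congruenceNumber f

/-! ## L3 — the least good prime is `N^{o(1)}` -/

/-- **L3 (S · where `ε` is spent).**  For every `ε > 0` there is `C > 0` such that every `N ≥ 1`
has a prime `ℓ ∤ N` with `ℓ ≤ C N^ε`.  Route: tree `LLLFactoring.exists_prime_le_not_dvd`
(`ℓ ≤ smallPrimeBound (log₂ N + 1) ≤ 64 (log₂ N + 1)²`, `smallPrimeBound_le`) and
`(log₂ N + 1)² ≤ C' N^ε` (`Real.log_natCast_le_rpow_div` with `ε/2`, `Nat.log 2 N ≤ log N / log 2`).
[cite: LenstraLenstraLovasz1982, proof of (3.6)] -/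
theorem exists_prime_not_dvd_le_rpow {ε : ℝ} (hε : 0 < ε) :
    ∃ C : ℝ, 0 < C ∧ ∀ N : ℕ, 1 ≤ N → ∃ ℓ : ℕ, ℓ.Prime ∧ ¬ ℓ ∣ N ∧ (ℓ : ℝ) ≤ C * (N : ℝ) ^ ε := by
  sorry

/-! ## L5 — `cps` bookkeeping -/

/-- **L5 (XS).** If `v_p x ≤ v_p r + v_p e` for all primes `p ≥ 5` (`r, e ≠ 0`) then
`cps x ≤ cps r · e` (`cps n = n / (2^{v₂ n} 3^{v₃ n})`): `cps x ∣ cps (r e)` prime-wise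
(k2 H6a `primeToSix_dvd_of_forall_prime_pow_dvd`), then tree `XiDegreeComparison.primeToSix_mul_le`. -/
theorem primeToSix_le_mul_of_factorization_le {x r e : ℕ} (hr : r ≠ 0) (he : e ≠ 0)
    (h : ∀ p : ℕ, p.Prime → 5 ≤ p → x.factorization p ≤ r.factorization p + e.factorization p) :
    x / (ordProj[2] x * ordProj[3] x) ≤ r / (ordProj[2] r * ordProj[3] r) * e := by
  sorry

/-! ## L6 — ARS 2.1(b) at the lattice-optimal datum (shared with k2's H6) -/

/-- **L6 (S).**  For the Frey curve and ANY datum `D` at its conductor `N`, `p ≥ 5`: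
`v_p r_{D.f} ≤ v_p (deg D)`.  Route (verbatim the opening of `XiDegreeComparison.primeToSix_deg_le_telescope`):
`D₀ := D.exists_optimalDatum'` (same newform, `ker = ⊥`, minimal among data with newform `D.f`
by `modularDegree_le_of_isogenyMap_ker_eq_bot`), `deg D₀ ∣ deg D` (`modularDegree_eq_card_ker_mul`),
ARS (b) at `D₀` for `p² ∤ N` (`N ∣ 2⁸ rad`, `conductorNorm_freyCurve_dvd_holds`, `p ≥ 5` — indeed `p ≥ 3`).
[cite: AgasheRibetStein2012, Thm. 2.1] -/
theorem factorization_congruenceNumber_le_deg (hARS : padicValNat_congruenceNumber_eq_of_not_sq_dvd)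
    {a b : ℤ} (hab : IsCoprime a b) (h0 : a * b * (a + b) ≠ 0) {N : ℕ} [NeZero N]
    (hN : (freyCurve a b).conductorNorm ℤ = N)
    (D : ModularParametrizationData (freyCurve a b) N) {p : ℕ} (hp : p.Prime) (h5 : 5 ≤ p) :
    (congruenceNumber D.f).factorization p ≤ D.deg.factorization p := by
  sorry

/-! ## L7 — assembly: the stub with `C = 4 C_ε`, no Mazur–Kenku -/

/-- **L7 (S · assembly).**  ORDER: fix `ε`, take `C₃` from L3 and `C := 4 C₃`.  Given `a b N Nm`,
`ξ ≠ 0`: `D` minimal (`exists_minimal_datum (hMod …)`), `haveI := isElliptic_freyCurve h0`;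
setup `S` of type `(N/Nm, Nm)` with `brandtXi = S.xi` (`exists_brandtXi_eq`) and generator `φ`
(`ξ ≠ 0 ⟹` line); `r := congruenceNumber D.f ≠ 0`; `ℓ` from L3 (`ℓ ∤ N = (N/Nm)·Nm`, `Nat.div_mul_cancel`);
for `p ≥ 5`: L2 (with `hcore := hX …`) + L6 ⟹ `v_p ξ ≤ v_p deg D + v_p |a_ℓ − ℓ − 1|`; L5 ⟹
`cps ξ ≤ cps (deg D) · |a_ℓ − ℓ − 1| ≤ cps (deg D) · 4ℓ ≤ 4 C₃ N^ε cps (deg D)` (L4, L3); finally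
`1 ≤ T³` (`factorization_minimalDiscriminantNorm_pos_of_dvd`).  `ε` is used at L3 only. -/
theorem stub_xiDegreeComparison_of_core (hX : XiCoreDivisibility)
    (hARS : padicValNat_congruenceNumber_eq_of_not_sq_dvd)
    (hMod : Summit.ABC.ABC.Theses.DefiniteXi.FreyModularity) :
    ∀ ε : ℝ, 0 < ε → ∃ C : ℝ, ∀ a b : ℤ, IsCoprime a b → a * b * (a + b) ≠ 0 → ∀ (N : ℕ) [NeZero N],
      (Literature.NumberTheory.EllipticCurves.freyCurve a b).conductorNorm ℤ = N →
      ∀ Nm : ℕ, Odd Nm → Squarefree Nm → Odd Nm.primeFactors.card → Nm ∣ N →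
      Literature.NumberTheory.Automorphic.brandtXi (N / Nm) Nm
          (fun n => (Literature.NumberTheory.EllipticCurves.freyCurve a b).LFunction n) ≠ 0 →
      ∃ D : Literature.NumberTheory.EllipticCurves.ModularForms.ModularParametrizationData
        (Literature.NumberTheory.EllipticCurves.freyCurve a b) N,
        (∀ D' : Literature.NumberTheory.EllipticCurves.ModularForms.ModularParametrizationData
          (Literature.NumberTheory.EllipticCurves.freyCurve a b) N, D.deg ≤ D'.deg) ∧
        ((Literature.NumberTheory.Automorphic.brandtXi (N / Nm) Nm
              (fun n => (Literature.NumberTheory.EllipticCurves.freyCurve a b).LFunction n) /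
            (ordProj[2] (Literature.NumberTheory.Automorphic.brandtXi (N / Nm) Nm
                (fun n => (Literature.NumberTheory.EllipticCurves.freyCurve a b).LFunction n)) *
              ordProj[3] (Literature.NumberTheory.Automorphic.brandtXi (N / Nm) Nm
                (fun n => (Literature.NumberTheory.EllipticCurves.freyCurve a b).LFunction n))) : ℕ) : ℝ) ≤
          C * (N : ℝ) ^ ε * ((D.deg / (ordProj[2] D.deg * ordProj[3] D.deg) : ℕ) : ℝ) *
            ((∏ q ∈ N.primeFactors, ((Literature.NumberTheory.EllipticCurves.freyCurve a b).minimalDiscriminantNorm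
              ℤ).factorization q : ℕ) : ℝ) ^ 3 := by
  sorry

/-! ## Sanity checks at the extremes (kernel-checked arithmetic of the 11a1 anatomy) -/

/-- 11a1, type `(N⁺,N⁻) = (1,11)`: `w = (2,3)`, `φ = (1,−1)`, `ξ = 2·1 + 3·1 = 5`, `r = m = 1`,
`#E(𝔽₂) = 2 + 1 − a₂ = 5` (`a₂ = −2`): L2 reads `v₅ 5 ≤ v₅ 1 + v₅ 5`, i.e. `1 ≤ 0 + 1` — TIGHT. -/
example : ((-2 : ℤ) - (2 + 1)).natAbs = 5 ∧ (2 * 1 ^ 2 + 3 * 1 ^ 2 : ℕ) = 5 := by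
  refine ⟨?_, by norm_num⟩
  decide

end Summit.ABC.ABC.Cruxes.SteinbergCore.ProbeExtremesG4

end
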